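import Mathlib.RingTheory.RamificationInertia.Ramification
import Mathlib.RingTheory.RamificationInertia.Inertia
import Mathlib.Data.Finsupp.Basic
import Mathlib.Data.NNReal.Basic
import Mathlib.Analysis.SpecialFunctions.Trigonometric.Basic
import Literature.IUT.HodgeTheaters.InitialThetaData
import HarnessLib

/-!
# [IUTchI] Example 3.5 (and the value-group data of Examples 3.2 (iv), 3.3 (i)–(ii), 3.4 (iii)):
# global realified Frobenioids — the divisor-monoid level, REAL over `ℝ≥0`

S. Mochizuki, *Inter-universal Teichmüller theory I*, §3, Example 3.5 "Global Realified
Frobenioids" (kurims final manuscript May 2020, pp. 84–86), with the local value-group data it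
consumes from Examples 3.2 (iv) (p. 71), 3.3 (i)–(ii) (p. 78), 3.4 (iii) (p. 81), and Remarks
3.5.1 (i) (p. 86), 3.8.1 (i) (p. 90) [claim: Mochizuki2012, status: disputed]. DEFINITIONS only.

The Frobenioids `C⊩_mod`, `C⊩_tht`, `C⊢_v`, `C^Θ_v` themselves are INTERFACE objects
(`ThetaHodgeTheaters.lean`, `HodgeTheaterModel`). What is typed REAL here is their **divisor /
realified-divisor monoids with the distinguished elements and the comparison isomorphisms `ρ_v`,
`ρ^Θ_v`** — everything on pp. 84–86 that is a statement about monoids isomorphic to `ℝ≥0`: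

* `Φ_{C⊩_mod}`: "the divisor monoid … may be thought of as a single abstract monoid, whose set of
  primes … is in natural bijective correspondence with `V_mod`"; "`Φ_{C⊩_mod,v} ≅
  ord(𝒪^▷_{(F_mod)_v})^pf ⊗ ℝ≥0 (≅ ℝ≥0)`"; "`p_v` determines an element `log⊢_mod(p_v) ∈ Φ_{C⊩_mod,v}`"
  — typed as the free `ℝ≥0`-module on `V_mod` (`PhiMod`, finitely supported functions) with the
  COORDINATE CONVENTION `log⊢_mod(p_v) ↦ 1` in the `v`-component (`logMod`).
* `Φ^rlf_{C⊢_v̲}` "may be regarded as a single abstract monoid isomorphic to `ℝ≥0`", with the element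
  `log_Φ(p_v)` (and, at `v̲ ∈ V̲^bad`, the generator `log_Φ(q̲_v)` of `Φ_{C⊢_v̲} = ℕ·log_Φ(q̲_v)`,
  Ex. 3.2 (iv)) — typed as `ℝ≥0` with the COORDINATE CONVENTION `log_Φ(p_v) ↦ 1` for
  `v̲ ∈ V̲^good`, `log_Φ(q̲_v) ↦ 1` for `v̲ ∈ V̲^bad`; the ratio "`log_Φ(p_v)/log_Φ(q̲_v) ∈ ℚ_{>0}`"
  (Ex. 3.5 (ii)) is the rational number `thetaRatio` computed from `q̲_v := q_v^{1/2l}` (Ex. 3.2 (iv))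
  and `ord_v(q_v)` (Def. 3.1 (c), `qParamOrd`): `ord(p_v)/ord(q̲_v) = 2l·e(K_v̲/ℚ_p)/ord_{K_v̲}(q_v)`.
* `ρ_v : Φ_{C⊩_mod,v} ⥲ Φ^rlf_{C⊢_v̲}`, "`log⊢_mod(p_v) ↦ [K_v̲:(F_mod)_v]⁻¹ log_Φ(p_v)`" (Ex. 3.5 (i))
  and `ρ^Θ_v` (Ex. 3.5 (ii)): "`log⊢_mod(p_v)·log(Θ) ↦ [K_v:(F_mod)_v]⁻¹ log_Φ(p_v)·log(Θ)`" at good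
  `v`, "`↦ (log_Φ(p_v) / ([K_v:(F_mod)_v]·log_Φ(q̲_v)))·log_Φ(Θ̲_v)`" at bad `v` — typed as the
  positive scalars `rhoScalar`, `rhoThetaScalar` of these `ℝ≥0`-linear isomorphisms in the stated
  coordinates, with `[K_v̲ : (F_mod)_v]` the local degree (`localDegreeMod`, a product of
  ramification indices and inertia degrees along `F_mod ⊆ F ⊆ K`, resp. of multiplicities at
  archimedean places).
* `Φ_{C⊩_tht} := Φ_{C⊩_mod}·log(Θ)` "an isomorphic copy … generated by a formal symbol `log(Θ)`" and
  the natural isomorphism `F⊩_mod ⥲ F⊩_tht` — the identity in coordinates (`PhiTht`, `modToTht`);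
  Rmk 3.5.1 (i): "`log(Θ)` may be thought of as the result of identifying the various formal
  quotients `log_Φ(Θ̲_v)/log_Φ(q̲_v)`"; Rmk 3.8.1 (i): "the Θ-link maps `ⁿΘ̲_v ↦ ⁽ⁿ⁺¹⁾q̲_v`" — at the
  level typed here: an isomorphism of split Frobenioids `F^Θ_v ⥲ F⊢_v` carries the generator
  `log_Φ(Θ̲_v)` of `Φ_{C^Θ_v} ≅ ℕ` to the generator `log_Φ(q̲_v)` of `Φ_{C⊢_v} ≅ ℕ` (`thetaLinkDivisor`).

* Ex. 3.5 (iii), the `D`-version `F⊩_D = (D⊩_mod, Prime(D⊩_mod) ⥲ V̲, {D⊢_v̲}, {ρ^D_v̲})`: at the level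
  typed here `Φ_{D⊩_mod}` is another copy of `Φ_{C⊩_mod}`; "`log^D_Φ(p_v)`" is `e_v` times the
  Frobenius element of `(ℝ⊢_{≥0})_v` (`v` nonarchimedean, `e_v` the absolute ramification index of
  `K_v`) resp. the Frobenius element divided by `2π` (`v` archimedean) — typed as its coordinate
  `logDPhiCoord` in Frobenius-element units; `ρ^D_v : log^D_mod(p_v) ↦ [K_v:(F_mod)_v]⁻¹ log^D_Φ(p_v)`
  has the scalar `rhoScalar` again. The monoids `(ℝ⊢_{≥0})_v` themselves ([AbsTopIII] Prop. 5.8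
  (iii), (vi)) are abc-iut-L4-t3's.

Deliberately NOT here: the categories (interface file); "volume interpretations" beyond the
printed scalars; Rmk 3.5.1 (ii)–(iii), 3.5.2 (conventions). The coordinate conventions are ours and are the only
non-printed ingredient; every scalar below is the printed one in those coordinates.
-/

namespace Literature.IUT.HodgeTheaters

open NumberField IsDedekindDomain
open scoped NNReal

universe u v w

/-! ### Local degrees `[K_v̲ : (F_mod)_v]` -/

section LocalDegree

variable (A : Type u) {B : Type v} [Field A] [NumberField A] [Field B] [NumberField B] [Algebra A B]

/-- The local degree `[B_w : A_u]` of a finite extension of number fields `A ⊆ B` at a place `w` of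
`B` over the place `u` of `A` below it: `e(w|u)·f(w|u)` at a finite place (Mathlib's
`Ideal.ramificationIdx`, `Ideal.inertiaDeg`), the ratio of multiplicities (`1` or `2`) at an infinite
place (used in Ex. 3.5 (i) as `[K_v̲ : (F_mod)_v]`). [claim: Mochizuki2012, status: disputed] -/
noncomputable def Val.localDegree : Val B → ℕ
  | Sum.inl w => w.mult / (w.comap (algebraMap A B)).mult
  | Sum.inr w => w.maximalIdeal.asIdeal.ramificationIdx (𝓞 A) * w.maximalIdeal.asIdeal.inertiaDeg (𝓞 A)

end LocalDegree

section Ex35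

variable {F : Type u} {K : Type v} {Fbar : Type w} [Field F] [NumberField F] [Field K]
  [NumberField K] [Algebra F K] [Field Fbar] [Algebra F Fbar] [Algebra K Fbar]
  {E : WeierstrassCurve F} [E.IsElliptic] {l : ℕ} {P : BadPlacePredicates K} (D : InitialThetaData F K Fbar E l P)

namespace InitialThetaData

/-- `[K_v̲ : (F_mod)_v]` for `v̲ ∈ V(K)` over `v ∈ V_mod` (Ex. 3.5 (i)), computed along
`F_mod ⊆ F ⊆ K`. [claim: Mochizuki2012, status: disputed] -/
noncomputable def localDegreeMod (_D : InitialThetaData F K Fbar E l P) (w : Val K) : ℕ :=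
  Val.localDegree F w * Val.localDegree (fieldOfModuli E) (Val.restrict F w)

/-! ### `Φ_{C⊩_mod}`, `Φ_{C⊩_tht}` and their distinguished elements -/

/-- `Φ_{C⊩_mod}`: the divisor monoid of the global realified Frobenioid `C⊩_mod` (Ex. 3.5 (i)), "a
single abstract monoid, whose set of primes … is in natural bijective correspondence with `V_mod`",
each prime component `≅ ℝ≥0` — typed as finitely supported `V_mod → ℝ≥0`, the `v`-coordinate
normalised by `log⊢_mod(p_v) ↦ 1`. [claim: Mochizuki2012, status: disputed] -/
abbrev PhiMod (_D : InitialThetaData F K Fbar E l P) : Type u := Val (fieldOfModuli E) →₀ ℝ≥0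

/-- `log⊢_mod(p_v) ∈ Φ_{C⊩_mod,v} ⊆ Φ_{C⊩_mod}` (Ex. 3.5 (i)) — the coordinate vector at `v`.
[claim: Mochizuki2012, status: disputed] -/
noncomputable def logMod (v : Val (fieldOfModuli E)) : D.PhiMod := Finsupp.single v 1

/-- `Φ_{C⊩_mod,v} ⊆ Φ_{C⊩_mod}`, the submonoid corresponding to the prime `v` (Ex. 3.5 (i)).
[claim: Mochizuki2012, status: disputed] -/
def PhiModAt (v : Val (fieldOfModuli E)) : AddSubmonoid D.PhiMod where
  carrier := {x | ∀ v', v' ≠ v → x v' = 0}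
  add_mem' {x y} hx hy v' hv' := by simp [hx v' hv', hy v' hv']
  zero_mem' _ _ := rfl

/-- `Φ_{C⊩_tht} := Φ_{C⊩_mod}·log(Θ)`, "an isomorphic copy of `Φ_{C⊩_mod}` generated by a formal symbol
`log(Θ)`" (Ex. 3.5 (ii)) — the same coordinates, `log⊢_mod(p_v)·log(Θ) ↦ 1`.
[claim: Mochizuki2012, status: disputed] -/
abbrev PhiTht (_D : InitialThetaData F K Fbar E l P) : Type u := Val (fieldOfModuli E) →₀ ℝ≥0

/-- The natural isomorphism `Φ_{C⊩_mod} ⥲ Φ_{C⊩_tht}`, `log⊢_mod(p_v) ↦ log⊢_mod(p_v)·log(Θ)` underlying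
"the natural equivalence of categories `C⊩_mod ⥲ C⊩_tht`" and "the natural isomorphism
`F⊩_mod ⥲ F⊩_tht`" (Ex. 3.5 (ii)) — the identity in coordinates. [claim: Mochizuki2012, status: disputed] -/
noncomputable def modToTht : D.PhiMod ≃+ D.PhiTht := AddEquiv.refl _

/-! ### The local realified monoids and the ratio `log_Φ(p_v)/log_Φ(q̲_v)` -/

/-- `Φ^rlf_{C⊢_v̲}` "regarded as a single abstract monoid isomorphic to `ℝ≥0`" (Ex. 3.5 (i)) — typed as
`ℝ≥0`, normalised by `log_Φ(p_v) ↦ 1` for `v̲ ∈ V̲^good` (Ex. 3.3 (i)–(ii), 3.4 (iii): `Φ_{C⊢_v}` is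
generated by `log(p_v)`) and by `log_Φ(q̲_v) ↦ 1` for `v̲ ∈ V̲^bad` (Ex. 3.2 (iv):
`Φ_{C⊢_v} = ℕ·log_Φ(q̲_v)`). [claim: Mochizuki2012, status: disputed] -/
abbrev PhiDashRlf (_D : InitialThetaData F K Fbar E l P) (_w : Val K) : Type := ℝ≥0

/-- `Φ^rlf_{C^Θ_v̲} ≅ ℝ≥0`, normalised by `log_Φ(p_v)·log(Θ) ↦ 1` for `v̲ ∈ V̲^good` (Ex. 3.3 (ii), 3.4
(iii)) and by `log_Φ(Θ̲_v) ↦ 1` for `v̲ ∈ V̲^bad` (Ex. 3.2 (v): `𝒪^▷_{C^Θ_v} = 𝒪^× · Θ̲_v^ℕ`).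
[claim: Mochizuki2012, status: disputed] -/
abbrev PhiThetaRlf (_D : InitialThetaData F K Fbar E l P) (_w : Val K) : Type := ℝ≥0

/-- "`log_Φ(p_v)/log_Φ(q̲_v) ∈ ℚ_{>0}`" at a finite place `w = v̲` of `K` of bad reduction
(Ex. 3.5 (ii); Ex. 3.2 (iv): `q̲_v := q_v^{1/2l}`, so `ord(q̲_v) = ord(q_v)/2l`): the ratio of orders
`ord_{K_w}(p_v) / ord_{K_w}(q̲_v) = 2l·e(K_w|ℚ_p) / (e(K_w|F_u)·ord_{F_u}(q_v))`, `u` the place of `F`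
below `w`, `ord_{F_u}(q_v) = qParamOrd` (Def. 3.1 (c)). [claim: Mochizuki2012, status: disputed] -/
noncomputable def thetaRatio (_D : InitialThetaData F K Fbar E l P) (w : HeightOneSpectrum (𝓞 K)) : ℚ :=
  (2 * l * w.asIdeal.ramificationIdx ℤ : ℚ) /
    (w.asIdeal.ramificationIdx (𝓞 F) * qParamOrd E (w.under (𝓞 F)) : ℚ)

/-! ### The comparison isomorphisms `ρ_v`, `ρ^Θ_v` -/

/-- The scalar of `ρ_v : Φ_{C⊩_mod,v} ⥲ Φ^rlf_{C⊢_v̲}` in the coordinates `log⊢_mod(p_v) ↦ 1`,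
`log_Φ(p_v) ↦ 1`: "`log⊢_mod(p_v) ↦ [K_v̲:(F_mod)_v]⁻¹ log_Φ(p_v)`" (Ex. 3.5 (i)); `w = v̲`.
[claim: Mochizuki2012, status: disputed] -/
noncomputable def rhoScalar (w : Val K) : ℝ≥0 := (D.localDegreeMod w : ℝ≥0)⁻¹

/-- `ρ_v` itself at `w = v̲ ∈ V̲^good`, as the `ℝ≥0`-linear isomorphism of the `v`-component onto
`Φ^rlf_{C⊢_v̲}` determined by its scalar (Ex. 3.5 (i): "`C_{ρ_v}` is determined, up to isomorphism, by
the isomorphism of topological monoids `ρ_v`"). [claim: Mochizuki2012, status: disputed] -/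
noncomputable def rho (w : Val K) : ℝ≥0 →+ D.PhiDashRlf w :=
  (DistribSMul.toAddMonoidHom ℝ≥0 (D.rhoScalar w) : ℝ≥0 →+ ℝ≥0)

open scoped Classical in
/-- The scalar of `ρ^Θ_v : Φ_{C⊩_tht,v} ⥲ Φ^rlf_{C^Θ_v̲}` (Ex. 3.5 (ii)) in the coordinates
`log⊢_mod(p_v)·log(Θ) ↦ 1` and `log_Φ(p_v)·log(Θ) ↦ 1` (good `v`) resp. `log_Φ(Θ̲_v) ↦ 1` (bad `v`):
"`↦ [K_v:(F_mod)_v]⁻¹ log_Φ(p_v)·log(Θ)`" for `v̲ ∈ V̲^good`, and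
"`↦ (log_Φ(p_v) / ([K_v:(F_mod)_v]·log_Φ(q̲_v))) · log_Φ(Θ̲_v)`" for `v̲ ∈ V̲^bad`; `w = v̲`.
[claim: Mochizuki2012, status: disputed] -/
noncomputable def rhoThetaScalar (w : Val K) : ℝ≥0 :=
  match w with
  | Sum.inl _ => D.rhoScalar w
  | Sum.inr w' =>
      if w ∈ D.Vbad then D.rhoScalar w * Real.toNNReal (D.thetaRatio w'.maximalIdeal : ℝ)
      else D.rhoScalar w

/-- In the bad-place coordinates `log_Φ(q̲_v) ↦ 1` of `Φ^rlf_{C⊢_v̲}`, the element `log_Φ(p_v)` is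
`thetaRatio`, so `ρ_v` reads "`log⊢_mod(p_v) ↦ [K_v:(F_mod)_v]⁻¹·(log_Φ(p_v)/log_Φ(q̲_v))·log_Φ(q̲_v)`"
— the SAME scalar as `ρ^Θ_v`; this is the compatibility "the various `ρ_v`, `ρ^Θ_v` are compatible
with the natural isomorphisms `C⊩_mod ⥲ C⊩_tht`, `C⊢_v ⥲ C^Θ_v`" of Ex. 3.5 (ii) (the latter sending
`log_Φ(q̲_v) ↦ log_Φ(Θ̲_v)`, Ex. 3.2 (v)), here by definition. [claim: Mochizuki2012, status: disputed] -/
noncomputable def rhoScalarBadCoords (w : Val K) : ℝ≥0 := D.rhoThetaScalar w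

/-! ### Remarks 3.5.1 (i) and 3.8.1 (i) at the divisor-monoid level -/

/-- `Φ_{C⊢_v̲} = ℕ·log_Φ(q̲_v)` (`v̲ ∈ V̲^bad`, Ex. 3.2 (iv)) resp. `ℕ·log(p_v)` (`v̲ ∈ V̲^good ∩ V̲^non`,
Ex. 3.3 (i): `ord(ℤ_{p_v}^▷)`): the (non-realified) divisor monoid of `C⊢_v̲` at a nonarchimedean
`v̲`, a copy of `ℕ` with its generator. [claim: Mochizuki2012, status: disputed] -/
abbrev PhiDash (_D : InitialThetaData F K Fbar E l P) (_w : HeightOneSpectrum (𝓞 K)) : Type := ℕ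

/-- `Φ_{C^Θ_v̲} = ℕ·log_Φ(Θ̲_v)` (`v̲ ∈ V̲^bad`, Ex. 3.2 (v)) resp. `ℕ·log(p_v)·log(Θ)` (good nonarchimedean
`v̲`, Ex. 3.3 (ii)). [claim: Mochizuki2012, status: disputed] -/
abbrev PhiTheta (_D : InitialThetaData F K Fbar E l P) (_w : HeightOneSpectrum (𝓞 K)) : Type := ℕ

/-- Rmk 3.8.1 (i) / Ex. 3.2 (v) at the divisor-monoid level: an isomorphism of split Frobenioids
`F^Θ_v ⥲ F⊢_v` (as induced by any member of the Θ-link, Cor. 3.7 (i)) carries the generator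
`log_Φ(Θ̲_v)` of `Φ_{C^Θ_v} ≅ ℕ` to the generator `log_Φ(q̲_v)` of `Φ_{C⊢_v} ≅ ℕ` — "the Θ-link maps
`ⁿΘ̲_v ↦ ⁽ⁿ⁺¹⁾q̲_v`": the unique monoid isomorphism `ℕ ≅ ℕ`. [claim: Mochizuki2012, status: disputed] -/
def thetaLinkDivisor (w : HeightOneSpectrum (𝓞 K)) : D.PhiTheta w ≃+ D.PhiDash w := AddEquiv.refl ℕ

/-- The divisor-monoid isomorphism of Rmk 3.8.1 (i) is forced: `ℕ` has a unique additive
automorphism, so ANY isomorphism `Φ_{C^Θ_v} ⥲ Φ_{C⊢_v}` sends `log_Φ(Θ̲_v) ↦ log_Φ(q̲_v)` — PROVED.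
[claim: Mochizuki2012, status: disputed] -/
theorem thetaLinkDivisor_unique (w : HeightOneSpectrum (𝓞 K)) (e : D.PhiTheta w ≃+ D.PhiDash w) :
    e 1 = 1 := by
  have h1 : e 1 ≠ 0 := by
    intro h; exact one_ne_zero ((map_eq_zero_iff e e.injective).mp h)
  obtain ⟨k, hk⟩ := e.surjective 1
  have : k * e 1 = 1 := by
    have := map_nsmul e k 1
    simp only [smul_eq_mul, mul_one] at this
    rw [← this, ← hk]
  exact Nat.eq_one_of_mul_eq_one_left this

/-- Rmk 3.5.1 (i): "the formal symbol `log(Θ)` may be thought of as the result of identifying the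
various formal quotients `log_Φ(Θ̲_v)/log_Φ(q̲_v)`, as `v` varies over `V^bad`" — at the level typed
here: for every bad `v̲` the passage from `ρ_v` to `ρ^Θ_v` is the same operation (replace the
generator `log_Φ(q̲_v)` by `log_Φ(Θ̲_v)`), independently of `v̲`; recorded as the equality of scalars.
[claim: Mochizuki2012, status: disputed] -/
theorem rhoThetaScalar_eq_rhoScalarBadCoords (w : Val K) :
    D.rhoThetaScalar w = D.rhoScalarBadCoords w := rfl

/-! ### Example 3.5 (iii): the `D`-version at the divisor-monoid level -/

/-- `Φ_{D⊩_mod}` for "`D⊩_mod`, a [i.e., another] copy of `C⊩_mod`" (Ex. 3.5 (iii)) — the same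
coordinates, `log^D_mod(p_v) ↦ 1`. [claim: Mochizuki2012, status: disputed] -/
abbrev PhiDMod (_D : InitialThetaData F K Fbar E l P) : Type u := Val (fieldOfModuli E) →₀ ℝ≥0

/-- The tautological isomorphism `Φ_{C⊩_mod} ⥲ Φ_{D⊩_mod}` underlying "the tautological equivalence of
categories `C⊩_mod ⥲ D⊩_mod`" (Ex. 3.5 (iii)). [claim: Mochizuki2012, status: disputed] -/
noncomputable def modToDMod : D.PhiMod ≃+ D.PhiDMod := AddEquiv.refl _

/-- The coordinate of "`log^D_Φ(p_v) ∈ (ℝ⊢_{≥0})_v`" in units of the distinguished Frobenius element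
(Ex. 3.5 (iii)): "the result of multiplying this Frobenius element by [the positive real number]
`e_v`", `e_v` the absolute ramification index of the MLF `K_v̲` (`v̲` nonarchimedean); "the result of
dividing this Frobenius element by [the positive real number] `2π`" (`v̲` archimedean).
[claim: Mochizuki2012, status: disputed] -/
noncomputable def logDPhiCoord (_D : InitialThetaData F K Fbar E l P) : Val K → ℝ
  | Sum.inl _ => (2 * Real.pi)⁻¹
  | Sum.inr w => (w.maximalIdeal.asIdeal.ramificationIdx ℤ : ℝ)

/-- The scalar of `ρ^D_v : Φ_{D⊩_mod,v} ⥲ (ℝ⊢_{≥0})_v`, "`log^D_mod(p_v) ↦ [K_v̲:(F_mod)_v]⁻¹ log^D_Φ(p_v)`"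
(Ex. 3.5 (iii)), in the coordinates `log^D_mod(p_v) ↦ 1`, `log^D_Φ(p_v) ↦ 1`: the same scalar as
`ρ_v`. [claim: Mochizuki2012, status: disputed] -/
noncomputable def rhoDScalar (w : Val K) : ℝ≥0 := D.rhoScalar w

end InitialThetaData

end Ex35

end Literature.IUT.HodgeTheaters
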